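import Mathlib
import HarnessLib
import Summits.Ventures.LatticeQCDFlow.Exactness.NCMCGeneralSpaceKishSampleSizeCorrelated
import Summits.Ventures.LatticeQCDFlow.Exactness.NCMCGeneralSpaceRestartChainSampleSize
import Summits.Ventures.LatticeQCDFlow.Exactness.NCMCGeneralSpaceSampleSizeMarginals

/-!
# NCMCGeneralSpaceKishSampleSizeRestartChain — the Kish denominator from CORRELATED forward records:
# with `P_F` marginals and a variance-inflation factor `C` on bounded observables,
# `N ≥ C·e^{L₂ + t}` records estimate `E_F e^{−2W}` to relative accuracy `√C·e^{−t/4} + tail`;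
# along the restart chain with `K(z,·) ≥ ε·π₀`, `C = 2/ε − 1`

HONEST FRAMING: exact (Metropolis-corrected) sampling algorithms for lattice gauge theory;
figures of merit are autocorrelation/cost numbers at stated couplings and volumes; no
continuum-physics claim.

Venture `LatticeQCDFlow` (cell pub-lqcd); FANOUT row 19 (`su2-snf`, GEN-8).  OUR WORK (bookkeeping);
nothing is cited as a fact.  `Exactness/NCMCGeneralSpaceKishSampleSize` (GEN-7) gives the
Chatterjee–Diaconis law of the Kish denominator for INDEPENDENT forward records: proposal `P_F`,
target the doubly-tilted record law `P₂ = P_F.tilted(−2W)`, density `ρ₂ = e^{−2W}/E_F e^{−2W}`,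
exponent `L₂ = KL(P₂ ‖ P_F)`.  The estimated function is the constant `1` — bounded — so the
BOUNDED-CLASS correlated sufficiency law of `Exactness/NCMCGeneralSpaceSampleSizeVarianceInflation`
applies verbatim to any joint law `Q` of `N` records with `P_F` marginals and a variance-inflation
factor `C` on bounded observables, and `Exactness/NCMCGeneralSpaceRestartChainSampleSize` supplies
`C = 2/ε − 1` for the engine's equilibrium restart chain under a level sampler minorised by the
normalised prior law.

* (the general bounded-class sufficiency `CrooksPair.kish_sampleSize_sufficient_of_varianceInflation`
  is the companion `Exactness/NCMCGeneralSpaceKishSampleSizeCorrelated`, imported;)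
* **`CrooksPair.kish_sampleSize_sufficient_restartChain`** — the equilibrium restart chain with a
  `ν₀`-invariant Markov `K`, `ε·(Z₀⁻¹ν₀)(B) ≤ K(z, B)`, `ε > 0`: the same along `N` consecutive
  evolutions with `C = 2/ε − 1`.

* **`CrooksPair.kish_sampleSize_necessary_of_marginals`**, **`…_necessary_restartChain`** (§2) —
  the NECESSITY half for ANY joint law with `P_F` marginals / along the restart chain with ANY
  `ν₀`-invariant level sampler: no mixing input (row 19's `…SampleSizeMarginals` with target `P₂`).

Reading (value-free): the printed Kish fraction's denominator needs `N_eff = N/(2/ε − 1) ≳ e^{L₂}`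
consecutive evolutions (`L₂ = log ÊSS + 2(ΔF − ⟨W⟩₂)` in the finite dictionary of
`Scaling/KishSampleSize`; `≤ log(E_F e^{−4W}/(E_F e^{−2W})²)` by the GEN-8 append to
`Exactness/NCMCGeneralSpaceKishSampleSize`).  NOT CLAIMED: a Doeblin constant for any concrete sweep; any number of ours.
-/

namespace Summit.Ventures.LatticeQCDFlow.Exactness.GeneralNCMC

open MeasureTheory ProbabilityTheory Set Filter Finset
open scoped ENNReal
open Literature.Probability.ImportanceSampling (isEstimate)

variable {Ω E : Type*} [MeasurableSpace Ω] [MeasurableSpace E]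

namespace CrooksPair

variable {ν₀ ν₁ : Measure Ω} {κF κR : Kernel Ω E} {s e : E → Ω} {W : E → ℝ}

/-- **KISH DENOMINATOR ALONG THE RESTART CHAIN (sufficiency).**  Crooks pair with
`e^{−2W} ∈ L¹(P_F)`; `ν₀`-invariant Markov level sampler `K` with `ε·(Z₀⁻¹ν₀)(B) ≤ K(z, B)`, `ε > 0`;
`N ≥ e^{L₂ + t}`.  Along the equilibrium restart chain of forward records,
`E|(1/N)Σ_{i<N} e^{−2W(εᵢ)}/E_F e^{−2W} − 1| ≤ √(2/ε − 1)·e^{−t/4} + 2√(P₂{L₂ + t/2 < log ρ₂})` — the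
sample second moment of the Jarzynski weights needs `N_eff = N/(2/ε − 1) ≳ e^{L₂}` consecutive
evolutions. -/
theorem kish_sampleSize_sufficient_restartChain (K : Kernel Ω Ω) [IsMarkovKernel K]
    [IsFiniteMeasure ν₀] [IsMarkovKernel κF] (h0 : ν₀ univ ≠ 0) (hK : Kernel.Invariant K ν₀)
    (h : CrooksPair ν₀ ν₁ κF κR s e W)
    (hint : Integrable (fun ε => Real.exp (-(2 * W ε))) (fwdPathLaw ν₀ κF))
    {ε : ℝ≥0∞} (hε0 : 0 < ε)
    (hmin : ∀ z (B : Set Ω), MeasurableSet B → ε * ((ν₀ univ)⁻¹ • ν₀) B ≤ K z B)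
    {N : ℕ} {t : ℝ}
    (hN : Real.exp ((∫ ε', (-(2 * W ε')
        - Real.log (∫ ε'', Real.exp (-(2 * W ε'')) ∂(fwdPathLaw ν₀ κF)))
          ∂((fwdPathLaw ν₀ κF).tilted fun ε' => -(2 * W ε'))) + t) ≤ N) :
    haveI := isProbabilityMeasure_fwdPathLaw ν₀ h0 κF
    ∫ x, |(1 / (N : ℝ)) * ∑ i ∈ range N, Real.exp (-(2 * W (x i)))
          / ∫ ε', Real.exp (-(2 * W ε')) ∂(fwdPathLaw ν₀ κF) - 1|
        ∂(Kernel.trajMeasure (X := fun _ : ℕ => E) (fwdPathLaw ν₀ κF)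
          (fun n : ℕ => ((κF ∘ₖ K).comap s h.measurable_s).comap
            (fun hh : (j : ↥(Finset.Iic n)) → E => hh ⟨n, Finset.mem_Iic.2 le_rfl⟩)
            (measurable_pi_apply _)))
      ≤ Real.sqrt (2 / ε.toReal - 1) * Real.exp (-t / 4)
        + 2 * Real.sqrt (((fwdPathLaw ν₀ κF).tilted fun ε' => -(2 * W ε'))
          {ε' | (∫ ε', (-(2 * W ε') - Real.log (∫ ε'', Real.exp (-(2 * W ε'')) ∂(fwdPathLaw ν₀ κF)))
              ∂((fwdPathLaw ν₀ κF).tilted fun ε' => -(2 * W ε'))) + t / 2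
            < -(2 * W ε') - Real.log (∫ ε'', Real.exp (-(2 * W ε'')) ∂(fwdPathLaw ν₀ κF))}).toReal := by
  haveI := isProbabilityMeasure_fwdPathLaw ν₀ h0 κF
  set R := (κF ∘ₖ K).comap s h.measurable_s with hR
  set P := Kernel.trajMeasure (X := fun _ : ℕ => E) (fwdPathLaw ν₀ κF)
      (fun n : ℕ => R.comap (fun hh : (j : ↥(Finset.Iic n)) → E => hh ⟨n, Finset.mem_Iic.2 le_rfl⟩)
        (measurable_pi_apply _)) with hP
  have hπ : Kernel.Invariant R (fwdPathLaw ν₀ κF) := h.invariant_restartKernel K hK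
  have hminR : ∀ x {B : Set E}, MeasurableSet B → ε * (fwdPathLaw ν₀ κF) B ≤ R x B := by
    intro x B hBm
    rw [fwdPathLaw_eq_bind_smul]
    exact minorized_comp_comap K κF h.measurable_s hmin x B hBm
  have hr : Measurable (fun (x : ℕ → E) (j : Fin N) => x j) :=
    measurable_pi_lambda _ fun j => measurable_pi_apply _
  set Q := P.map (fun (x : ℕ → E) (j : Fin N) => x j) with hQ
  haveI : IsProbabilityMeasure Q := Measure.isProbabilityMeasure_map hr.aemeasurable
  have hmarg : ∀ i : Fin N, Q.map (fun y => y i) = fwdPathLaw ν₀ κF := fun i => by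
    rw [hQ, hP]; exact chain_firstCoords_map_eval R hπ N i
  have hε1 : ε ≤ 1 := Scoring.eps_le_one_of_doeblin hminR
  have hεr0 : 0 < ε.toReal :=
    ENNReal.toReal_pos hε0.ne' (ne_top_of_le_ne_top ENNReal.one_ne_top hε1)
  have hεr : ε.toReal ≤ 1 := by
    have := ENNReal.toReal_mono ENNReal.one_ne_top hε1
    simpa using this
  have hC0 : 0 ≤ 2 / ε.toReal - 1 := by
    rw [sub_nonneg, le_div_iff₀ hεr0]; linarith
  have hvar : ∀ g : E → ℝ, Measurable g → ∀ B' : ℝ, (∀ ε', |g ε'| ≤ B') →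
      Var[fun y : Fin N → E => ∑ i, g (y i); Q]
        ≤ (2 / ε.toReal - 1) * N * Var[g; fwdPathLaw ν₀ κF] := by
    intro g hg B' hB'
    rw [hQ, hP]
    exact chain_variance_sum_le_of_doeblin R hπ hminR hε0 hg hB' N
  have key := h.kish_sampleSize_sufficient_of_varianceInflation h0 hint Q hmarg hC0 hvar hN
  have hW := h.measurable_W
  have hintm : Measurable (fun y : Fin N → E => |(1 / (N : ℝ)) * ∑ i, Real.exp (-(2 * W (y i)))
      / ∫ ε', Real.exp (-(2 * W ε')) ∂(fwdPathLaw ν₀ κF) - 1|) := by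
    refine Measurable.abs ((measurable_const.mul (Finset.measurable_sum _ fun i _ => ?_)).sub
      measurable_const)
    exact (Real.measurable_exp.comp ((hW.comp (measurable_pi_apply i)).const_mul 2).neg).div_const _
  rw [hQ, integral_map hr.aemeasurable hintm.aestronglyMeasurable] at key
  have hcomp : ∀ x : ℕ → E, (∑ i : Fin N, Real.exp (-(2 * W (x i)))
      / ∫ ε', Real.exp (-(2 * W ε')) ∂(fwdPathLaw ν₀ κF))
      = ∑ i ∈ range N, Real.exp (-(2 * W (x i)))
          / ∫ ε', Real.exp (-(2 * W ε')) ∂(fwdPathLaw ν₀ κF) := fun x =>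
    Fin.sum_univ_eq_sum_range (fun i => Real.exp (-(2 * W (x i)))
      / ∫ ε', Real.exp (-(2 * W ε')) ∂(fwdPathLaw ν₀ κF)) N
  simp only [hcomp] at key
  exact key

/-! ## §2 Necessity: identical `P_F` marginals alone (no mixing input) -/

/-- **KISH DENOMINATOR, NECESSITY, WITHOUT INDEPENDENCE.**  `e^{−2W} ∈ L¹(P_F)`; ANY finite measure
`Q` on `Fin N → E` whose one-record marginals are `P_F`; `N ≤ e^{L₂ − t}`, `δ < 1`.  Then
`Q{ (1/N)Σᵢ e^{−2W(εᵢ)}/E_F e^{−2W} ≥ 1 − δ } ≤ e^{−t/2} + P₂{ρ₂ ≤ e^{L₂ − t/2}}/(1 − δ)` — the sample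
second moment of the weights under-shoots whatever the correlations (row 19's general
`sampleSize_necessary_of_marginals` with target `P₂ = P_F.tilted(−2W)`). -/
theorem kish_sampleSize_necessary_of_marginals [IsFiniteMeasure ν₀] [IsMarkovKernel κF]
    (h0 : ν₀ univ ≠ 0) (h : CrooksPair ν₀ ν₁ κF κR s e W)
    (hint : Integrable (fun ε => Real.exp (-(2 * W ε))) (fwdPathLaw ν₀ κF))
    {N : ℕ} (Q : Measure (Fin N → E)) [IsFiniteMeasure Q]
    (hmarg : ∀ i : Fin N, Q.map (fun x => x i) = fwdPathLaw ν₀ κF) {t : ℝ}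
    (hN : (N : ℝ) ≤ Real.exp ((∫ ε, (-(2 * W ε)
        - Real.log (∫ ε', Real.exp (-(2 * W ε')) ∂(fwdPathLaw ν₀ κF)))
          ∂((fwdPathLaw ν₀ κF).tilted fun ε => -(2 * W ε))) - t))
    {δ : ℝ} (hδ1 : δ < 1) :
    Q.real {x | 1 - δ ≤ (1 / (N : ℝ)) * ∑ i, Real.exp (-(2 * W (x i)))
          / ∫ ε', Real.exp (-(2 * W ε')) ∂(fwdPathLaw ν₀ κF)}
      ≤ Real.exp (-t / 2)
        + ((fwdPathLaw ν₀ κF).tilted fun ε => -(2 * W ε)).real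
            {ε | Real.exp (-(2 * W ε)) / ∫ ε', Real.exp (-(2 * W ε')) ∂(fwdPathLaw ν₀ κF)
              ≤ Real.exp ((∫ ε, (-(2 * W ε)
                  - Real.log (∫ ε', Real.exp (-(2 * W ε')) ∂(fwdPathLaw ν₀ κF)))
                    ∂((fwdPathLaw ν₀ κF).tilted fun ε => -(2 * W ε))) - t / 2)} / (1 - δ) := by
  haveI := isProbabilityMeasure_fwdPathLaw ν₀ h0 κF
  haveI : IsProbabilityMeasure ((fwdPathLaw ν₀ κF).tilted fun ε => -(2 * W ε)) :=
    isProbabilityMeasure_tilted hint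
  have hkl := integral_log_rnDeriv_sqTilt (ν₀ := ν₀) (κF := κF) (W := W) h0 hint
  have hgen := GeneralNCMC.sampleSize_necessary_of_marginals (fwdPathLaw ν₀ κF)
    ((fwdPathLaw ν₀ κF).tilted fun ε => -(2 * W ε)) (tilted_absolutelyContinuous _ _) Q hmarg
    (t := t) (by rwa [hkl]) hδ1
  rw [hkl] at hgen
  have hZ0 : 0 ≤ ∫ ε', Real.exp (-(2 * W ε')) ∂(fwdPathLaw ν₀ κF) := (integral_exp_pos hint).le
  -- the event, up to a `Q`-null set
  have hae : ∀ᵐ x ∂Q, ∀ i : Fin N,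
      (((fwdPathLaw ν₀ κF).tilted fun ε => -(2 * W ε)).rnDeriv (fwdPathLaw ν₀ κF) (x i)).toReal
        = Real.exp (-(2 * W (x i))) / ∫ ε', Real.exp (-(2 * W ε')) ∂(fwdPathLaw ν₀ κF) := by
    rw [ae_all_iff]
    intro i
    have hq : Measure.QuasiMeasurePreserving (fun x : Fin N → E => x i) Q (fwdPathLaw ν₀ κF) := by
      refine ⟨measurable_pi_apply i, ?_⟩
      rw [hmarg i]
    filter_upwards [hq.ae_eq (h.rnDeriv_sqTilt_ae h0)] with x hx
    have hx' : ((fwdPathLaw ν₀ κF).tilted fun ε => -(2 * W ε)).rnDeriv (fwdPathLaw ν₀ κF) (x i)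
        = ENNReal.ofReal (Real.exp (-(2 * W (x i)))
          / ∫ ε', Real.exp (-(2 * W ε')) ∂(fwdPathLaw ν₀ κF)) := hx
    rw [hx', ENNReal.toReal_ofReal (div_nonneg (Real.exp_pos _).le hZ0)]
  have hev : {x : Fin N → E | 1 - δ ≤ (1 / (N : ℝ)) * ∑ i,
        (((fwdPathLaw ν₀ κF).tilted fun ε => -(2 * W ε)).rnDeriv (fwdPathLaw ν₀ κF) (x i)).toReal}
      =ᵐ[Q] ({x : Fin N → E | 1 - δ ≤ (1 / (N : ℝ)) * ∑ i, Real.exp (-(2 * W (x i)))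
          / ∫ ε', Real.exp (-(2 * W ε')) ∂(fwdPathLaw ν₀ κF)} : Set _) := by
    filter_upwards [hae] with x hx
    simp only [eq_iff_iff]
    dsimp only [setOf]
    rw [Finset.sum_congr rfl fun i _ => hx i]
  -- the tail event, up to a `P₂`-null set
  have htail : {ε | (((fwdPathLaw ν₀ κF).tilted fun ε => -(2 * W ε)).rnDeriv (fwdPathLaw ν₀ κF)
        ε).toReal ≤ Real.exp ((∫ ε, (-(2 * W ε)
          - Real.log (∫ ε', Real.exp (-(2 * W ε')) ∂(fwdPathLaw ν₀ κF)))
            ∂((fwdPathLaw ν₀ κF).tilted fun ε => -(2 * W ε))) - t / 2)}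
      =ᵐ[(fwdPathLaw ν₀ κF).tilted fun ε => -(2 * W ε)]
        ({ε | Real.exp (-(2 * W ε)) / ∫ ε', Real.exp (-(2 * W ε')) ∂(fwdPathLaw ν₀ κF)
          ≤ Real.exp ((∫ ε, (-(2 * W ε)
              - Real.log (∫ ε', Real.exp (-(2 * W ε')) ∂(fwdPathLaw ν₀ κF)))
                ∂((fwdPathLaw ν₀ κF).tilted fun ε => -(2 * W ε))) - t / 2)} : Set E) := by
    filter_upwards [(tilted_absolutelyContinuous _ _).ae_eq (h.rnDeriv_sqTilt_ae h0)] with ε hε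
    simp only [eq_iff_iff]
    dsimp only [setOf]
    have hε' : ((fwdPathLaw ν₀ κF).tilted fun ε => -(2 * W ε)).rnDeriv (fwdPathLaw ν₀ κF) ε
        = ENNReal.ofReal (Real.exp (-(2 * W ε))
          / ∫ ε', Real.exp (-(2 * W ε')) ∂(fwdPathLaw ν₀ κF)) := hε
    rw [hε', ENNReal.toReal_ofReal (div_nonneg (Real.exp_pos _).le hZ0)]
  rw [measureReal_congr hev, measureReal_congr htail] at hgen
  exact hgen

/-- **KISH DENOMINATOR ALONG THE RESTART CHAIN, NECESSITY — no mixing hypothesis.**  Any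
`ν₀`-invariant Markov level sampler `K` (any `n_between`); along the equilibrium restart chain,
`N ≤ e^{L₂ − t}` consecutive evolutions ⇒
`P( (1/N)Σ_{i<N} e^{−2W(εᵢ)}/E_F e^{−2W} ≥ 1 − δ ) ≤ e^{−t/2} + P₂{ρ₂ ≤ e^{L₂ − t/2}}/(1 − δ)`. -/
theorem kish_sampleSize_necessary_restartChain (K : Kernel Ω Ω) [IsMarkovKernel K]
    [IsFiniteMeasure ν₀] [IsMarkovKernel κF] (h0 : ν₀ univ ≠ 0) (hK : Kernel.Invariant K ν₀)
    (h : CrooksPair ν₀ ν₁ κF κR s e W)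
    (hint : Integrable (fun ε => Real.exp (-(2 * W ε))) (fwdPathLaw ν₀ κF))
    {N : ℕ} {t : ℝ}
    (hN : (N : ℝ) ≤ Real.exp ((∫ ε, (-(2 * W ε)
        - Real.log (∫ ε', Real.exp (-(2 * W ε')) ∂(fwdPathLaw ν₀ κF)))
          ∂((fwdPathLaw ν₀ κF).tilted fun ε => -(2 * W ε))) - t))
    {δ : ℝ} (hδ1 : δ < 1) :
    haveI := isProbabilityMeasure_fwdPathLaw ν₀ h0 κF
    (Kernel.trajMeasure (X := fun _ : ℕ => E) (fwdPathLaw ν₀ κF)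
        (fun n : ℕ => ((κF ∘ₖ K).comap s h.measurable_s).comap
          (fun hh : (j : ↥(Finset.Iic n)) → E => hh ⟨n, Finset.mem_Iic.2 le_rfl⟩)
          (measurable_pi_apply _))).real
      {x : ℕ → E | 1 - δ ≤ (1 / (N : ℝ)) * ∑ i ∈ range N, Real.exp (-(2 * W (x i)))
          / ∫ ε', Real.exp (-(2 * W ε')) ∂(fwdPathLaw ν₀ κF)}
      ≤ Real.exp (-t / 2)
        + ((fwdPathLaw ν₀ κF).tilted fun ε => -(2 * W ε)).real
            {ε | Real.exp (-(2 * W ε)) / ∫ ε', Real.exp (-(2 * W ε')) ∂(fwdPathLaw ν₀ κF)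
              ≤ Real.exp ((∫ ε, (-(2 * W ε)
                  - Real.log (∫ ε', Real.exp (-(2 * W ε')) ∂(fwdPathLaw ν₀ κF)))
                    ∂((fwdPathLaw ν₀ κF).tilted fun ε => -(2 * W ε))) - t / 2)} / (1 - δ) := by
  haveI := isProbabilityMeasure_fwdPathLaw ν₀ h0 κF
  set R := (κF ∘ₖ K).comap s h.measurable_s with hR
  set P := Kernel.trajMeasure (X := fun _ : ℕ => E) (fwdPathLaw ν₀ κF)
      (fun n : ℕ => R.comap (fun hh : (j : ↥(Finset.Iic n)) → E => hh ⟨n, Finset.mem_Iic.2 le_rfl⟩)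
        (measurable_pi_apply _)) with hP
  have hW := h.measurable_W
  have hπ : Kernel.Invariant R (fwdPathLaw ν₀ κF) := h.invariant_restartKernel K hK
  have hr : Measurable (fun (x : ℕ → E) (j : Fin N) => x j) :=
    measurable_pi_lambda _ fun j => measurable_pi_apply _
  set Q := P.map (fun (x : ℕ → E) (j : Fin N) => x j) with hQ
  haveI : IsFiniteMeasure Q := Measure.isFiniteMeasure_map P _
  have hmarg : ∀ i : Fin N, Q.map (fun y => y i) = fwdPathLaw ν₀ κF := fun i => by
    rw [hQ, hP]; exact chain_firstCoords_map_eval R hπ N i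
  have key := h.kish_sampleSize_necessary_of_marginals h0 hint Q hmarg hN hδ1
  have hSm : MeasurableSet {y : Fin N → E | 1 - δ ≤ (1 / (N : ℝ)) * ∑ i,
      Real.exp (-(2 * W (y i))) / ∫ ε', Real.exp (-(2 * W ε')) ∂(fwdPathLaw ν₀ κF)} :=
    measurableSet_le measurable_const (measurable_const.mul (Finset.measurable_sum _ fun i _ =>
      (Real.measurable_exp.comp ((hW.comp (measurable_pi_apply i)).const_mul 2).neg).div_const _))
  rw [hQ, map_measureReal_apply hr hSm] at key
  have hpre : (fun (x : ℕ → E) (j : Fin N) => x j) ⁻¹'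
        {y : Fin N → E | 1 - δ ≤ (1 / (N : ℝ)) * ∑ i, Real.exp (-(2 * W (y i)))
          / ∫ ε', Real.exp (-(2 * W ε')) ∂(fwdPathLaw ν₀ κF)}
      = {x : ℕ → E | 1 - δ ≤ (1 / (N : ℝ)) * ∑ i ∈ range N, Real.exp (-(2 * W (x i)))
          / ∫ ε', Real.exp (-(2 * W ε')) ∂(fwdPathLaw ν₀ κF)} := by
    ext x
    simp only [Set.mem_preimage, Set.mem_setOf_eq]
    rw [Fin.sum_univ_eq_sum_range (fun i => Real.exp (-(2 * W (x i)))
      / ∫ ε', Real.exp (-(2 * W ε')) ∂(fwdPathLaw ν₀ κF)) N]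
  rw [hpre] at key
  exact key

end CrooksPair

end Summit.Ventures.LatticeQCDFlow.Exactness.GeneralNCMC
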